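import Summits.QuantumFields.YangMills.Theorems.BalabanLadderIRCofinalCouplingsSeam
import Summits.QuantumFields.YangMills.Theorems.BalabanLadderIRPinnedExit96
import HarnessLib

/-!
# IR cell, crux `BalabanLadder.IR` (stmt-QuantumFields-19354) after R423: the X-FREE COFINAL KERNEL —
# pinned exits at COFINALLY MANY couplings already give the clustering family on a cofinal set (no AF pin, no floor, no sign)

HONEST FRAMING.  Content-free glue over landed seams.  Nothing here proves the Yang–Mills mass gap (Clay), the crux `IR`, its cofinal
re-typing, or the existence of a single pure box; R4 (`BalabanUVStability4`) closes only the conditional finite-𝕋⁴ rung `BalabanLadder.UV`.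

CONTEXT (ideator ym-ir-idea-11, line `thermal-ratchet`, lens «finite»; ruling R423: the summit consumes the IR leg only on a COFINAL set of
couplings, `Y2Bridge.yangMills_of_cofinalLegs`).  The leaf of record `K1 ∧ X ∧ N` (line `cofinal-leaf`) still carries the AF pin
`X = AFToColdPressure`, used at EVERY large coupling (`ColdPressurePincer.gapOn_exitSet_of_af` via `cp_pinned`).  The thermal ratchet's
certificate stub pins each certified box in floor units instead (`a(β)·L ≤ T`).  This file records that such PINNED EXITS AT COFINALLY MANY
COUPLINGS are already enough for the cofinal clustering family — with NO statement at the couplings in between: no AF pin, no heredity sign,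
not even the floor `LowerBounds`.

* `gapOn_of_coldPressure_pinned_onSet` — the rate seam of `cofinal-leaf` (`gapOn_of_coldPressure_pinned_on`, idea-12) with the PIN hypothesis
  restricted to the set `Bset` as well (its proof only ever used the pin on `Bset`; `0 < T` is now an explicit hypothesis).
* `cofinalGapOn_of_pinnedExits` — **THE X-FREE COFINAL KERNEL** (every compact `G`, every `r`, every positive `a`→0): if for every `β₁` some
  `β ≥ β₁` carries ONE cold `4:1` box `L ≥ 8` with `a(β)·L ≤ T` and purity defect `δᶜ_β(L) ≤ 1/24`, then on the (cofinal) set of such couplings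
  the `GapInUnits` clustering family holds with one rate `a(β)/(16384·T + 1)` and species-uniform constants.  Proof: at such `β` the tree's
  climb-to-cold-pressure `PinnedExit96.coldPressureAt_widen_24` (idea-14, over `PurityClimb.coldDefect_widen_24`) gives `ColdPressureAt` at
  `16384·L`, hence `cpLength ≤ 16384·L` and the pin `a(β)·cpLength ≤ 16384·T`; then the seam above.
* `ircofSC_of_pinnedExitsCofinal` — the simply-connected half of the cofinal leaf `IRcof` (unfolded, as consumed by `yangMills_of_cofinalLegs`)
  from the unfolded hypothesis **PXcof(1/24)** «under the floor, pinned `1/24`-pure cold boxes at cofinally many couplings»; `_le` for any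
  tolerance `θ ≤ 1/24`.
* `pinnedExitsCofinal_of_pinnedExitAt` — PX_θ (idea-14's slot of record, ALL large β) ⇒ PXcof_θ (cofinally many β): the slot's stub may be
  relaxed to its cofinal form for the summit after R423.

bears_on: R2c (19354) — summit role via the cofinal bridge; the uniform crux `IR` is NOT reached from PXcof.
-/

set_option autoImplicit false

noncomputable section

open Filter Topology MeasureTheory
open scoped SchwartzMap
open Literature.MathematicalPhysics.QuantumFieldTheory Literature.MathematicalPhysics.QuantumLattice
open Summit.QuantumFields.YangMills.Cruxes.OSLegsFromFemtoAndGap.DlrCollarTransfer (GapInUnits LowerBounds Q2)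
open Summit.QuantumFields.YangMills.Theorems.WeakCouplingHypercubicLimit.TraceNormColdPressure
  (abs_latticeConnectedCorr_le_of_coldPressure)
open Summit.QuantumFields.YangMills.Cruxes.IR.FluxCodeBlindness (volumeFloor_eventually)
open Summit.QuantumFields.YangMills.Cruxes.IR.ColdPurityBridge (coldDefect)
open Summit.QuantumFields.YangMills.Cruxes.IR.ColdPressurePincer
open Summit.QuantumFields.YangMills.Cruxes.IR.PinnedExit96 (PinnedExitAt coldPressureAt_widen_24)

namespace Summit.QuantumFields.YangMills.Cruxes.IR.PinnedExitCofinal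

variable {G : Type} [Group G] [TopologicalSpace G] [IsTopologicalGroup G] [CompactSpace G]
  [MeasurableSpace G] [BorelSpace G]

/-! ## §1 The rate seam with onset AND pin on a set of couplings -/

/-- **Rate seam on a set of couplings, pin on the same set** (idea-12's `gapOn_of_coldPressure_pinned_on` with `hpin` restricted to `Bset`;
`0 < T` explicit; same constants, same proof). -/
theorem gapOn_of_coldPressure_pinned_onSet (r : LatticeRep G) (a : ℝ → ℝ) (ha : ∀ β, 0 < a β)
    (ha0 : Tendsto a atTop (𝓝 0)) {β₂ : ℝ} (Bset : Set ℝ)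
    (hon : ∀ β ∈ Bset, β₂ ≤ β → ∃ ξ : ℕ, 1 ≤ ξ ∧ ColdPressureAt r.ρ β ξ)
    {T β₆ : ℝ} (hT : 0 < T) (hpin : ∀ β ∈ Bset, β₆ ≤ β → a β * (cpLength r.ρ β : ℝ) < T) :
    ∃ (c₁ β₂ : ℝ) (S₁ : ℝ → ℕ), 0 < c₁ ∧ ∀ A B : YMSpecies G, ∃ C : ℝ, ∀ β ∈ Bset, β₂ ≤ β →
      ∀ S n : ℕ, S₁ β ≤ S → n ≤ S →
        |latticeConnectedCorr r.ρ β (2 * S + 1) A.F B.F n| ≤ C * Real.exp (-(c₁ * a β * n)) := by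
  classical
  -- eventually `a β ≤ T`
  obtain ⟨β₇, hβ₇⟩ : ∃ β₇ : ℝ, ∀ β : ℝ, β₇ ≤ β → a β ≤ T := by
    have hev : ∀ᶠ β in atTop, a β < T := ha0.eventually (gt_mem_nhds hT)
    obtain ⟨β₇, h⟩ := Filter.eventually_atTop.1 hev
    exact ⟨β₇, fun β hβ => (h β hβ).le⟩
  set β₈ : ℝ := max (max β₂ β₆) (max β₇ 0) with hβ₈
  -- the per-β package at the uniform rate `a β / T`
  have hR : ∀ β : ℝ, β ∈ Bset → β₈ ≤ β → ∃ S₂ : ℕ, ∃ C₀ : ℝ, 0 ≤ C₀ ∧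
      (∀ S : ℕ, S₂ ≤ S → C₀ * ((2 * S + 1 : ℕ) : ℝ) ^ 3 * Real.exp (-(a β / T * S / 2)) ≤ 1) ∧
      (∀ S : ℕ, S₂ ≤ S → ∀ m : ℕ, S + 1 ≤ 2 * (m + 2) →
        traceExcess r.ρ β (2 * S + 1) (m + 2) ≤
          C₀ * ((2 * S + 1 : ℕ) : ℝ) ^ 3 * Real.exp (-(a β / T * ((m + 2 : ℕ) : ℝ)))) := by
    intro β hβmem hβ
    have hβ2 : β₂ ≤ β := le_trans (le_trans (le_max_left _ _) (le_max_left _ _)) hβ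
    have hβ6 : β₆ ≤ β := le_trans (le_trans (le_max_right _ _) (le_max_left _ _)) hβ
    obtain ⟨ξ, hξ, hcp⟩ := hon β hβmem hβ2
    obtain ⟨h1, hcpL⟩ := cpLength_spec r.ρ β ⟨ξ, hξ, hcp⟩
    obtain ⟨C₀, S₁, hC₀, hP⟩ := hcpL
    have hμ0 : 0 < a β / T := div_pos (ha β) hT
    obtain ⟨S₀, hS₀⟩ := Filter.eventually_atTop.1 (volumeFloor_eventually C₀ (a β / T) hC₀ hμ0)
    refine ⟨max S₁ S₀, C₀, hC₀, fun S hS => hS₀ S (le_trans (le_max_right _ _) hS), fun S hS m hm => ?_⟩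
    have hP1 := hP S (le_trans (le_max_left _ _) hS) m hm
    refine hP1.trans ?_
    have hV : 0 ≤ C₀ * ((2 * S + 1 : ℕ) : ℝ) ^ 3 := by positivity
    refine mul_le_mul_of_nonneg_left (Real.exp_le_exp.2 ?_) hV
    have hξpos : (0 : ℝ) < (cpLength r.ρ β : ℝ) := by exact_mod_cast h1
    have hm0 : (0 : ℝ) ≤ ((m + 2 : ℕ) : ℝ) := Nat.cast_nonneg _
    have hpinβ : a β * (cpLength r.ρ β : ℝ) < T := hpin β hβmem hβ6
    have hrate : a β / T ≤ 1 / (cpLength r.ρ β : ℝ) := by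
      rw [div_le_div_iff₀ hT hξpos]
      linarith
    have hmul : a β / T * ((m + 2 : ℕ) : ℝ) ≤ 1 / (cpLength r.ρ β : ℝ) * ((m + 2 : ℕ) : ℝ) :=
      mul_le_mul_of_nonneg_right hrate hm0
    linarith
  -- the size threshold `S₁ β` (junk `0` below `β₈`)
  let S₁ : ℝ → ℕ := fun β => if h : β ∈ Bset ∧ β₈ ≤ β then Classical.choose (hR β h.1 h.2) else 0
  refine ⟨1 / T, β₈, S₁, by positivity, fun A B => ?_⟩
  obtain ⟨CA, hCA⟩ := A.bounded
  obtain ⟨CB, hCB⟩ := B.bounded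
  obtain ⟨w, hw⟩ := abs_latticeConnectedCorr_le_of_coldPressure r A B hCA hCB
  refine ⟨max (CA * CB * Real.exp (2 * w) * (2 + 4 * 1 + 1 ^ 2)) (2 * (CA * CB) * Real.exp (2 * w)),
    fun β hβmem hβ S n hS hn => ?_⟩
  have hS₁ : S₁ β = Classical.choose (hR β hβmem hβ) := dif_pos ⟨hβmem, hβ⟩
  obtain ⟨C₀, hC₀, hK, hP⟩ := Classical.choose_spec (hR β hβmem hβ)
  rw [hS₁] at hS
  have hβ0 : 0 ≤ β := le_trans (le_trans (le_max_right _ _) (le_max_right _ _)) hβ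
  have hβ7 : β₇ ≤ β := le_trans (le_trans (le_max_left _ _) (le_max_right _ _)) hβ
  have hμ0 : 0 ≤ a β / T := (div_pos (ha β) hT).le
  have hμ1 : a β / T ≤ 1 := by
    rw [div_le_one hT]
    exact hβ₇ β hβ7
  have hmain := hw β hβ0 (a β / T) C₀ 1 hμ0 hμ1 hC₀ _ hK hP S n hS hn
  have hexp : Real.exp (-(a β / T * n)) = Real.exp (-(1 / T * a β * n)) := by
    congr 1
    ring
  rw [hexp] at hmain
  exact hmain

/-! ## §2 The X-free cofinal kernel -/

/-- **THE X-FREE COFINAL KERNEL (every compact `G`, every `r`, every positive unit map `a → 0`; no floor, no AF pin, no sign).**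
If for every `β₁` some coupling `β ≥ β₁` carries ONE cold `4:1` box of half-side `L ≥ 8` with `a(β)·L ≤ T` and purity defect `≤ 1/24`, then the
`GapInUnits` clustering family holds on a COFINAL set of couplings (the set of such `β ≥ 0`), with one rate and species-uniform constants. -/
theorem cofinalGapOn_of_pinnedExits (r : LatticeRep G) (a : ℝ → ℝ) (ha : ∀ β, 0 < a β) (ha0 : Tendsto a atTop (𝓝 0))
    {T : ℝ} (hcof : ∀ β₁ : ℝ, ∃ β : ℝ, β₁ ≤ β ∧ ∃ L : ℕ, 8 ≤ L ∧ a β * (L : ℝ) ≤ T ∧ coldDefect r.ρ β L ≤ 1 / 24) :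
    ∃ Bset : Set ℝ, (∀ x : ℝ, ∃ β ∈ Bset, x ≤ β) ∧
      ∃ (c₁ β₂ : ℝ) (S₁ : ℝ → ℕ), 0 < c₁ ∧ ∀ A B : YMSpecies G, ∃ C : ℝ, ∀ β ∈ Bset, β₂ ≤ β →
        ∀ S n : ℕ, S₁ β ≤ S → n ≤ S →
          |latticeConnectedCorr r.ρ β (2 * S + 1) A.F B.F n| ≤ C * Real.exp (-(c₁ * a β * n)) := by
  set Bset : Set ℝ := {β : ℝ | 0 ≤ β ∧ ∃ L : ℕ, 8 ≤ L ∧ a β * (L : ℝ) ≤ T ∧ coldDefect r.ρ β L ≤ 1 / 24} with hBdef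
  have hTpos : 0 < T := by
    obtain ⟨β, -, L, hL, hpin, -⟩ := hcof 0
    have : 0 < a β * (L : ℝ) := mul_pos (ha β) (by exact_mod_cast (show 0 < L by omega))
    linarith
  refine ⟨Bset, fun x => ?_, ?_⟩
  · obtain ⟨β, hβ, L, hL, hpin, hδ⟩ := hcof (max x 0)
    exact ⟨β, ⟨le_trans (le_max_right _ _) hβ, L, hL, hpin, hδ⟩, le_trans (le_max_left _ _) hβ⟩
  · have hon : ∀ β ∈ Bset, (0 : ℝ) ≤ β → ∃ ξ : ℕ, 1 ≤ ξ ∧ ColdPressureAt r.ρ β ξ := by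
      rintro β ⟨hβ0, L, hL, -, hδ⟩ _
      exact ⟨16384 * L, by omega, coldPressureAt_widen_24 r hβ0 hL hδ⟩
    have hpin : ∀ β ∈ Bset, (0 : ℝ) ≤ β → a β * (cpLength r.ρ β : ℝ) < 16384 * T + 1 := by
      rintro β ⟨hβ0, L, hL, hpinL, hδ⟩ _
      have hcp := coldPressureAt_widen_24 r hβ0 hL hδ
      have hle : (cpLength r.ρ β : ℝ) ≤ ((16384 * L : ℕ) : ℝ) := by
        exact_mod_cast cpLength_le r.ρ β (by omega) hcp
      have hmul := mul_le_mul_of_nonneg_left hle (ha β).le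
      have : a β * ((16384 * L : ℕ) : ℝ) = 16384 * (a β * (L : ℝ)) := by push_cast; ring
      rw [this] at hmul
      nlinarith
    exact gapOn_of_coldPressure_pinned_onSet r a ha ha0 Bset hon (by linarith) hpin

/-- Tolerance monotonicity of the kernel's hypothesis: pinned exits at tolerance `θ ≤ 1/24` are pinned exits at `1/24`. -/
theorem cofinalGapOn_of_pinnedExits_le (r : LatticeRep G) (a : ℝ → ℝ) (ha : ∀ β, 0 < a β) (ha0 : Tendsto a atTop (𝓝 0))
    {θ T : ℝ} (hθ : θ ≤ 1 / 24)
    (hcof : ∀ β₁ : ℝ, ∃ β : ℝ, β₁ ≤ β ∧ ∃ L : ℕ, 8 ≤ L ∧ a β * (L : ℝ) ≤ T ∧ coldDefect r.ρ β L ≤ θ) :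
    ∃ Bset : Set ℝ, (∀ x : ℝ, ∃ β ∈ Bset, x ≤ β) ∧
      ∃ (c₁ β₂ : ℝ) (S₁ : ℝ → ℕ), 0 < c₁ ∧ ∀ A B : YMSpecies G, ∃ C : ℝ, ∀ β ∈ Bset, β₂ ≤ β →
        ∀ S n : ℕ, S₁ β ≤ S → n ≤ S →
          |latticeConnectedCorr r.ρ β (2 * S + 1) A.F B.F n| ≤ C * Real.exp (-(c₁ * a β * n)) :=
  cofinalGapOn_of_pinnedExits r a ha ha0 fun β₁ => by
    obtain ⟨β, hβ, L, hL, hpin, hδ⟩ := hcof β₁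
    exact ⟨β, hβ, L, hL, hpin, hδ.trans hθ⟩

/-! ## §3 The simply-connected half of the cofinal leaf from PXcof, and PX ⇒ PXcof -/

/-- **PXcof(θ ≤ 1/24) ⇒ the simply-connected half of the cofinal leaf `IRcof` (unfolded as consumed by `Y2Bridge.yangMills_of_cofinalLegs`).**
PXcof: under the crux's floor `LowerBounds G r a`, pinned `θ`-pure cold boxes at COFINALLY MANY couplings (`∃ T ∀ β₁ ∃ β ≥ β₁ ∃ L ≥ 8, a(β)·L ≤ T ∧
δᶜ_β(L) ≤ θ`).  No AF pin, no heredity sign, nothing at the couplings in between. -/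
theorem ircofSC_of_pinnedExitsCofinal_le {θ : ℝ} (hθ : θ ≤ 1 / 24)
    (hP : ∀ (G : Type) [Group G] [TopologicalSpace G] [IsTopologicalGroup G] [CompactSpace G],
      IsCompactSimpleLieGroup G → SimplyConnectedSpace G →
      letI : MeasurableSpace G := borel G
      haveI : BorelSpace G := ⟨rfl⟩
      ∀ (r : LatticeRep G) (a : ℝ → ℝ), (∀ β, 0 < a β) → Tendsto a atTop (𝓝 0) → LowerBounds G r a →
        ∃ T : ℝ, ∀ β₁ : ℝ, ∃ β : ℝ, β₁ ≤ β ∧ ∃ L : ℕ, 8 ≤ L ∧ a β * (L : ℝ) ≤ T ∧ coldDefect r.ρ β L ≤ θ) :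
    ∀ (G : Type) [Group G] [TopologicalSpace G] [IsTopologicalGroup G] [CompactSpace G],
      IsCompactSimpleLieGroup G → SimplyConnectedSpace G →
      letI : MeasurableSpace G := borel G
      haveI : BorelSpace G := ⟨rfl⟩
      ∀ (r : LatticeRep G) (a : ℝ → ℝ), (∀ β, 0 < a β) → Tendsto a atTop (𝓝 0) → LowerBounds G r a →
        ∃ Bset : Set ℝ, (∀ x : ℝ, ∃ β ∈ Bset, x ≤ β) ∧
          ∃ (c₁ β₂ : ℝ) (S₁ : ℝ → ℕ), 0 < c₁ ∧ ∀ A B : YMSpecies G, ∃ C : ℝ, ∀ β ∈ Bset, β₂ ≤ β →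
            ∀ S n : ℕ, S₁ β ≤ S → n ≤ S →
              |latticeConnectedCorr r.ρ β (2 * S + 1) A.F B.F n| ≤ C * Real.exp (-(c₁ * a β * n)) := by
  intro G _ _ _ _ hG hsc
  letI : MeasurableSpace G := borel G
  haveI : BorelSpace G := ⟨rfl⟩
  intro r a ha ha0 hlb
  obtain ⟨T, hcof⟩ := hP G hG hsc r a ha ha0 hlb
  exact cofinalGapOn_of_pinnedExits_le r a ha ha0 hθ hcof

/-- **PX_θ ⇒ PXcof_θ**: idea-14's pinned exit at ALL large couplings (`PinnedExit96.PinnedExitAt θ`, the LEAD's slot of record) gives pinned exits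
at cofinally many couplings — after R423 the slot's stub may be relaxed to this cofinal form for the summit (the uniform crux `IR` still wants PX). -/
theorem pinnedExitsCofinal_of_pinnedExitAt {θ : ℝ} (hP : PinnedExitAt θ) :
    ∀ (G : Type) [Group G] [TopologicalSpace G] [IsTopologicalGroup G] [CompactSpace G],
      IsCompactSimpleLieGroup G → SimplyConnectedSpace G →
      letI : MeasurableSpace G := borel G
      haveI : BorelSpace G := ⟨rfl⟩
      ∀ (r : LatticeRep G) (a : ℝ → ℝ), (∀ β, 0 < a β) → Tendsto a atTop (𝓝 0) → LowerBounds G r a →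
        ∃ T : ℝ, ∀ β₁ : ℝ, ∃ β : ℝ, β₁ ≤ β ∧ ∃ L : ℕ, 8 ≤ L ∧ a β * (L : ℝ) ≤ T ∧ coldDefect r.ρ β L ≤ θ := by
  intro G _ _ _ _ hG hsc
  letI : MeasurableSpace G := borel G
  haveI : BorelSpace G := ⟨rfl⟩
  intro r a ha ha0 hlb
  obtain ⟨T, β₁, h⟩ := hP G hG hsc r a ha ha0 hlb
  exact ⟨T, fun β₂ => ⟨max β₁ β₂, le_max_right _ _, h (max β₁ β₂) (le_max_left _ _)⟩⟩

end Summit.QuantumFields.YangMills.Cruxes.IR.PinnedExitCofinal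

end
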